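import Literature.AlgebraicGeometry.Frobenioids.PerfectionDivisorial
import Literature.AlgebraicGeometry.Frobenioids.ModelFrobenioidMap
import HarnessLib

/-!
# Frobenioids I, §0: the `N`-th root maps of the perfection `M^pf` and of `(M^pf)^gp`

Mochizuki, *The geometry of Frobenioids I: the general theory*, Kyushu J. Math. **62** (2008)
293–400, §0 "Monoids", kurims p. 11 [cite: MochizukiFrdI2008, §0 p.11]: "`M^pf := lim_→ M`" over
`(N_{≥1}, ∣)`; "`M^pf` is perfect", i.e. every `N`-th power map of `M^pf` is bijective.

Elementary bookkeeping used by the proof of [FrdI] Prop. 5.5 (iv) (`C^pf` of a model Frobenioid is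
the model Frobenioid of the perfected data, cell abc-iut L1 sub-DAG row P55-L08, seat abc-iut-w5-d120):

* `Perfection.root N : M^pf →* M^pf`, `a^{1/n} ↦ a^{1/(nN)}` — THE `N`-th root (`root_pow`,
  `pow_root`, `root_unique`), compatible with `Perfection.map` (`map_root`);
* `rootNatTrans Φ N : Φ^pf ⟶ Φ^pf` and `toPerfectionRoot Φ N := (Φ → Φ^pf) ≫ rootNatTrans`, the
  homomorphism of monoids on `D` "`a ↦ a^{1/N}`";
* on Grothendieck groups: `(M^pf)^gp` has injective power maps for `M` integral (`gp_pow_injective`),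
  so `(root N)^gp` is THE `N`-th root there (`gpRoot_pow`, `gpRoot_unique`); every element of
  `(M^pf)^gp` is `(ι^gp c)^{1/N}` for some `c ∈ M^gp` (`exists_gpApp_toPerfectionRoot_eq`); and the
  kernel of `ι^gp : M^gp → (M^pf)^gp` is torsion (`exists_pow_eq_pow_of_gpApp_toPerfectionFunctor_eq`).

Classical monoid algebra; nothing here bears on [IUTchIII] or asserts anything about abc.
-/

noncomputable section

namespace Literature.AlgebraicGeometry.Frobenioids

open CategoryTheory Opposite Function

universe w v u

namespace Perfection

variable {M N : Type u} [CommMonoid M] [CommMonoid N]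

/-! ### The `N`-th root on `M^pf` -/

/-- **The `N`-th root map of `M^pf`**: `a^{1/n} ↦ a^{1/(nN)}` (well defined on the inductive limit of
§0 p. 11; `M^pf` "is perfect"). [cite: MochizukiFrdI2008, §0 p.11] -/
def root (N : ℕ+) : Perfection M →* Perfection M where
  toFun := Quotient.map (fun x : M × ℕ+ => (x.1, x.2 * N)) fun x y h => by
    obtain ⟨K, hK⟩ := h
    refine ⟨K, ?_⟩
    show x.1 ^ ((K : ℕ) * ((y.2 * N : ℕ+) : ℕ)) = y.1 ^ ((K : ℕ) * ((x.2 * N : ℕ+) : ℕ))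
    rw [PNat.mul_coe, PNat.mul_coe, ← mul_assoc, ← mul_assoc, pow_mul, hK, ← pow_mul]
  map_one' := by
    show mk (1 : M) (1 * N) = 1
    exact mk_one _
  map_mul' x y := by
    obtain ⟨⟨a, n⟩, rfl⟩ := mk_surjective x
    obtain ⟨⟨b, m⟩, rfl⟩ := mk_surjective y
    show mk (a ^ (m : ℕ) * b ^ (n : ℕ)) (n * m * N) = mk (a ^ ((m * N : ℕ+) : ℕ) * b ^ ((n * N : ℕ+) : ℕ)) (n * N * (m * N))
    rw [show n * N * (m * N) = n * m * N * N from by rw [mul_mul_mul_comm, ← mul_assoc],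
      ← mk_pow_mul (a ^ (m : ℕ) * b ^ (n : ℕ)) (n * m * N) N, mul_pow, ← pow_mul, ← pow_mul,
      PNat.mul_coe, PNat.mul_coe]

/-- `root N (a^{1/n}) = a^{1/(nN)}`. [cite: MochizukiFrdI2008, §0 p.11] -/
@[simp] theorem root_mk (N : ℕ+) (a : M) (n : ℕ+) : root N (mk a n) = mk a (n * N) := rfl

/-- `root N (a) = a^{1/N}` on the image of `M`. [cite: MochizukiFrdI2008, §0 p.11] -/
theorem root_of (N : ℕ+) (a : M) : root N (of M a) = mk a N := by
  rw [of_apply, root_mk, one_mul]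

/-- `(root N x)^N = x`. [cite: MochizukiFrdI2008, §0 p.11] -/
theorem root_pow (N : ℕ+) (x : Perfection M) : root N x ^ (N : ℕ) = x := by
  obtain ⟨⟨a, n⟩, rfl⟩ := mk_surjective x
  show mk a (n * N) ^ (N : ℕ) = mk a n
  rw [mk_pow, mk_pow_mul]

/-- `root N (x^N) = x`. [cite: MochizukiFrdI2008, §0 p.11] -/
theorem pow_root (N : ℕ+) (x : Perfection M) : root N (x ^ (N : ℕ)) = x := by
  apply pow_injective N.pos
  show root N (x ^ (N : ℕ)) ^ (N : ℕ) = x ^ (N : ℕ)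
  rw [root_pow]

/-- Uniqueness of `N`-th roots in `M^pf`: `y^N = x ⟹ y = root N x`. [cite: MochizukiFrdI2008, §0 p.11] -/
theorem root_unique (N : ℕ+) {x y : Perfection M} (h : y ^ (N : ℕ) = x) : y = root N x := by
  rw [← h, pow_root]

/-- `root 1 = id`. [cite: MochizukiFrdI2008, §0 p.11] -/
@[simp] theorem root_one_apply (x : Perfection M) : root 1 x = x :=
  (root_unique 1 (by rw [PNat.one_coe, pow_one])).symm

/-- `root (N K) = root N ∘ root K`. [cite: MochizukiFrdI2008, §0 p.11] -/
theorem root_mul (N K : ℕ+) (x : Perfection M) : root (N * K) x = root N (root K x) := by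
  obtain ⟨⟨a, n⟩, rfl⟩ := mk_surjective x
  show mk a (n * (N * K)) = mk a (n * K * N)
  rw [mul_assoc, mul_comm K N]

/-- `(root (N K) x)^K = root N x`. [cite: MochizukiFrdI2008, §0 p.11] -/
theorem root_mul_pow (N K : ℕ+) (x : Perfection M) : root (N * K) x ^ (K : ℕ) = root N x := by
  rw [mul_comm, root_mul, root_pow]

/-- Every element of `M^pf` is the `n`-th root of an element of `M`: `a^{1/n} = root n (a)`.
[cite: MochizukiFrdI2008, §0 p.11] -/
theorem mk_eq_root_of (a : M) (n : ℕ+) : mk a n = root n (of M a) := by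
  rw [root_of]

/-- Every element of `M^pf` has a power in the image of `M`. [cite: MochizukiFrdI2008, §0 p.11] -/
theorem exists_pow_eq_of (x : Perfection M) : ∃ (t : ℕ+) (a : M), x ^ (t : ℕ) = of M a := by
  obtain ⟨⟨a, n⟩, rfl⟩ := mk_surjective x
  exact ⟨n, a, mk_pow_self a n⟩

/-- `root` commutes with `Perfection.map`. [cite: MochizukiFrdI2008, §0 p.11] -/
theorem map_root (f : M →* N) (K : ℕ+) (x : Perfection M) : map f (root K x) = root K (map f x) := by
  obtain ⟨⟨a, n⟩, rfl⟩ := mk_surjective x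
  rfl

/-- In a commutative monoid all of whose elements are units, `M^pf` has the same property.
[cite: MochizukiFrdI2008, §0 p.11] -/
theorem isUnit_of_forall_isUnit (hM : ∀ a : M, IsUnit a) (x : Perfection M) : IsUnit x := by
  obtain ⟨⟨a, n⟩, rfl⟩ := mk_surjective x
  obtain ⟨u, rfl⟩ := hM a
  refine IsUnit.of_mul_eq_one (mk (↑u⁻¹ : M) n) ?_
  show mk ((u : M) ^ (n : ℕ) * (↑u⁻¹ : M) ^ (n : ℕ)) (n * n) = 1
  rw [← mul_pow, Units.mul_inv, one_pow, mk_one]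

/-! ### `N`-th roots on `(M^pf)^gp` -/

/-- Every element of `P^gp` is a fraction of two elements of `P`. [cite: MochizukiFrdI2008, §0 p.11] -/
theorem gp_exists_eq_div {P : Type u} [CommMonoid P] (x : Algebra.GrothendieckGroup P) :
    ∃ a b : P, x = Algebra.GrothendieckGroup.of a / Algebra.GrothendieckGroup.of b := by
  obtain ⟨⟨a, b⟩, h⟩ := (Localization.monoidOf (⊤ : Submonoid P)).surj x
  exact ⟨a, b, eq_div_iff_mul_eq'.mpr h⟩

/-- `(root N)^gp` is an `N`-th root map on `(M^pf)^gp`. [cite: MochizukiFrdI2008, §0 p.11] -/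
theorem gpRoot_pow (N : ℕ+) (x : Algebra.GrothendieckGroup (Perfection M)) :
    MonGp.map (root N) x ^ (N : ℕ) = x := by
  have key : (powMonoidHom (N : ℕ)).comp (MonGp.map (root (M := M) N)) = MonoidHom.id _ := by
    apply MonGp.hom_ext
    intro a
    rw [MonoidHom.comp_apply, MonGp.map_of, powMonoidHom_apply, ← map_pow, root_pow, MonoidHom.id_apply]
  exact DFunLike.congr_fun key x

/-- For `M` integral (cancellative), the power maps of `(M^pf)^gp` are injective.
[cite: MochizukiFrdI2008, §0 p.11] -/
theorem gp_pow_injective [IsCancelMul M] (N : ℕ+) :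
    Injective fun x : Algebra.GrothendieckGroup (Perfection M) => x ^ (N : ℕ) := by
  have key : ∀ z : Algebra.GrothendieckGroup (Perfection M), z ^ (N : ℕ) = 1 → z = 1 := by
    intro z hz
    obtain ⟨p, q, hz'⟩ := gp_exists_eq_div z
    rw [hz', div_pow, ← map_pow, ← map_pow, div_eq_one] at hz
    have hpq' : p ^ (N : ℕ) = q ^ (N : ℕ) :=
      @Algebra.GrothendieckGroup.of_injective (Perfection M) _ Perfection.isCancelMul _ _ hz
    have : p = q := pow_injective N.pos hpq'
    rw [hz', this, div_self']
  intro x y hxy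
  have h : (x / y) ^ (N : ℕ) = 1 := by
    rw [div_pow]
    exact div_eq_one.mpr hxy
  exact div_eq_one.mp (key _ h)

/-- Uniqueness of `N`-th roots in `(M^pf)^gp` for `M` integral. [cite: MochizukiFrdI2008, §0 p.11] -/
theorem gpRoot_unique [IsCancelMul M] (N : ℕ+) {x y : Algebra.GrothendieckGroup (Perfection M)}
    (h : y ^ (N : ℕ) = x) : y = MonGp.map (root N) x := by
  apply gp_pow_injective N
  show y ^ (N : ℕ) = MonGp.map (root N) x ^ (N : ℕ)
  rw [gpRoot_pow, h]

/-- A homomorphism `g : P → (M^pf)^gp` (`M` integral) commutes with `N`-th roots: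
`(root N)^gp (g x) = g y` whenever `y^N = x`. [cite: MochizukiFrdI2008, §0 p.11] -/
theorem gpRoot_map_eq [IsCancelMul M] (N : ℕ+) {P : Type u} [CommMonoid P]
    (g : P →* Algebra.GrothendieckGroup (Perfection M)) {x y : P} (h : y ^ (N : ℕ) = x) :
    MonGp.map (root N) (g x) = g y :=
  (gpRoot_unique N (by rw [← map_pow, h])).symm

end Perfection

/-! ### The natural transformations `Φ^pf → Φ^pf`, `a ↦ a^{1/N}`, and `Φ → Φ^pf`, `a ↦ a^{1/N}` -/

section OnD

variable {D : Type u} [Category.{v} D] (Φ : Dᵒᵖ ⥤ CommMonCat.{w})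

/-- The `N`-th root as an endomorphism of the monoid `Φ^pf` on `D` (naturality = `map_root`).
[cite: MochizukiFrdI2008, §0 p.11] -/
def rootNatTrans (N : ℕ+) : perfectionFunctor Φ ⟶ perfectionFunctor Φ where
  app A := CommMonCat.ofHom (Perfection.root N)
  naturality X Y f := by
    apply CommMonCat.hom_ext
    ext x
    show Perfection.root N (Perfection.map (Φ.map f).hom x) = Perfection.map (Φ.map f).hom (Perfection.root N x)
    rw [Perfection.map_root]

/-- `ι_N : Φ → Φ^pf`, `a ↦ a^{1/N}` = `(Φ → Φ^pf) ≫ root N`. [cite: MochizukiFrdI2008, §0 p.11] -/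
def toPerfectionRoot (N : ℕ+) : Φ ⟶ perfectionFunctor Φ := toPerfectionFunctor Φ ≫ rootNatTrans Φ N

variable {Φ}

/-- Components of `ι_N`: `a ↦ root N (a) = a^{1/N}`. [cite: MochizukiFrdI2008, §0 p.11] -/
@[simp] theorem toPerfectionRoot_app_apply (N : ℕ+) (A : Dᵒᵖ) (a : Φ.obj A) :
    ((toPerfectionRoot Φ N).app A).hom a = Perfection.root N (Perfection.of (Φ.obj A) a) := rfl

/-- Components of `Φ → Φ^pf`. [cite: MochizukiFrdI2008, §0 p.11] -/
@[simp] theorem toPerfectionFunctor_app_apply (A : Dᵒᵖ) (a : Φ.obj A) :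
    ((toPerfectionFunctor Φ).app A).hom a = Perfection.of (Φ.obj A) a := rfl

/-- Components of `rootNatTrans`. [cite: MochizukiFrdI2008, §0 p.11] -/
@[simp] theorem rootNatTrans_app_apply (N : ℕ+) (A : Dᵒᵖ) (x : (perfectionFunctor Φ).obj A) :
    ((rootNatTrans Φ N).app A).hom x = Perfection.root N x := rfl

/-- `ι_1 = (Φ → Φ^pf)`. [cite: MochizukiFrdI2008, §0 p.11] -/
theorem toPerfectionRoot_one : toPerfectionRoot Φ 1 = toPerfectionFunctor Φ := by
  ext A a
  show Perfection.root 1 (Perfection.of (Φ.obj A) a) = Perfection.of (Φ.obj A) a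
  exact Perfection.root_one_apply _

/-- `ι_N^gp` on `Φ^gp`: `(ι_N^gp c)^N = ι^gp c`. [cite: MochizukiFrdI2008, §0 p.11] -/
theorem gpApp_toPerfectionRoot_pow (N : ℕ+) (A : Dᵒᵖ) (c : Algebra.GrothendieckGroup (Φ.obj A)) :
    gpApp (toPerfectionRoot Φ N) A c ^ (N : ℕ) = gpApp (toPerfectionFunctor Φ) A c := by
  have key : (powMonoidHom (N : ℕ)).comp (gpApp (toPerfectionRoot Φ N) A) = gpApp (toPerfectionFunctor Φ) A := by
    apply MonGp.hom_ext
    intro a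
    rw [MonoidHom.comp_apply, gpApp_of, gpApp_of, powMonoidHom_apply, ← map_pow]
    exact congrArg Algebra.GrothendieckGroup.of (Perfection.root_pow N (Perfection.of (Φ.obj A) a))
  exact DFunLike.congr_fun key c

/-- `ι_N^gp = (root N)^gp ∘ ι^gp`. [cite: MochizukiFrdI2008, §0 p.11] -/
theorem gpApp_toPerfectionRoot_eq (N : ℕ+) (A : Dᵒᵖ) (c : Algebra.GrothendieckGroup (Φ.obj A)) :
    gpApp (toPerfectionRoot Φ N) A c = MonGp.map (Perfection.root N) (gpApp (toPerfectionFunctor Φ) A c) := by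
  change MonGp.map (((toPerfectionFunctor Φ).app A ≫ (rootNatTrans Φ N).app A).hom) c = _
  rw [CommMonCat.hom_comp, MonGp.map_comp, MonoidHom.comp_apply]
  rfl

/-- `ι_{NK}^gp(c)^K = ι_N^gp(c)`. [cite: MochizukiFrdI2008, §0 p.11] -/
theorem gpApp_toPerfectionRoot_mul_pow (N K : ℕ+) (A : Dᵒᵖ) (c : Algebra.GrothendieckGroup (Φ.obj A)) :
    gpApp (toPerfectionRoot Φ (N * K)) A c ^ (K : ℕ) = gpApp (toPerfectionRoot Φ N) A c := by
  have key : (powMonoidHom (K : ℕ)).comp (gpApp (toPerfectionRoot Φ (N * K)) A) =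
      gpApp (toPerfectionRoot Φ N) A := by
    apply MonGp.hom_ext
    intro a
    rw [MonoidHom.comp_apply, gpApp_of, gpApp_of, powMonoidHom_apply, ← map_pow]
    exact congrArg Algebra.GrothendieckGroup.of
      (Perfection.root_mul_pow N K (Perfection.of (Φ.obj A) a))
  exact DFunLike.congr_fun key c

/-- **Every element of `(Φ(A)^pf)^gp` is `ι_N^gp(c)` for some `N` and `c ∈ Φ(A)^gp`.**
[cite: MochizukiFrdI2008, §0 p.11] -/
theorem exists_gpApp_toPerfectionRoot_eq (A : Dᵒᵖ)
    (γ : Algebra.GrothendieckGroup ((perfectionFunctor Φ).obj A)) :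
    ∃ (N : ℕ+) (c : Algebra.GrothendieckGroup (Φ.obj A)), gpApp (toPerfectionRoot Φ N) A c = γ := by
  obtain ⟨p, q, hγ⟩ := Perfection.gp_exists_eq_div γ
  obtain ⟨⟨a, n⟩, rfl⟩ := Perfection.mk_surjective p
  obtain ⟨⟨b, m⟩, rfl⟩ := Perfection.mk_surjective q
  refine ⟨n * m, Algebra.GrothendieckGroup.of (a ^ (m : ℕ)) / Algebra.GrothendieckGroup.of (b ^ (n : ℕ)), ?_⟩
  rw [map_div, gpApp_of, gpApp_of, hγ]
  have ha : ((toPerfectionRoot Φ (n * m)).app A).hom (a ^ (m : ℕ)) = Perfection.mk a n := by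
    show Perfection.root (n * m) (Perfection.of (Φ.obj A) (a ^ (m : ℕ))) = Perfection.mk a n
    rw [Perfection.root_of, Perfection.mk_pow_mul]
  have hb : ((toPerfectionRoot Φ (n * m)).app A).hom (b ^ (n : ℕ)) = Perfection.mk b m := by
    show Perfection.root (n * m) (Perfection.of (Φ.obj A) (b ^ (n : ℕ))) = Perfection.mk b m
    rw [Perfection.root_of, mul_comm n m, Perfection.mk_pow_mul]
  rw [ha, hb]

/-- **The kernel of `ι^gp : Φ(A)^gp → (Φ(A)^pf)^gp` is torsion** (`Φ(A)` integral): if `ι^gp x = ι^gp y`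
then `x^s = y^s` for some `s ≥ 1`. [cite: MochizukiFrdI2008, §0 p.11] -/
theorem exists_pow_eq_pow_of_gpApp_toPerfectionFunctor_eq (A : Dᵒᵖ) [IsCancelMul (Φ.obj A)]
    {x y : Algebra.GrothendieckGroup (Φ.obj A)}
    (h : gpApp (toPerfectionFunctor Φ) A x = gpApp (toPerfectionFunctor Φ) A y) :
    ∃ s : ℕ+, x ^ (s : ℕ) = y ^ (s : ℕ) := by
  obtain ⟨a, b, hx⟩ := Perfection.gp_exists_eq_div x
  obtain ⟨c, d, hy⟩ := Perfection.gp_exists_eq_div y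
  rw [hx, hy, map_div, map_div, gpApp_of, gpApp_of, gpApp_of, gpApp_of, div_eq_div_iff_mul_eq_mul] at h
  have h' : Perfection.of (Φ.obj A) (a * d) = Perfection.of (Φ.obj A) (c * b) := by
    apply @Algebra.GrothendieckGroup.of_injective (Perfection (Φ.obj A)) _ Perfection.isCancelMul
    simp only [map_mul]
    exact h
  obtain ⟨s, hs⟩ := Perfection.of_eq_of_iff.mp h'
  refine ⟨s, ?_⟩
  rw [hx, hy, div_pow, div_pow, div_eq_div_iff_mul_eq_mul, ← map_pow, ← map_pow, ← map_pow, ← map_pow,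
    ← map_mul, ← map_mul, ← mul_pow, ← mul_pow, hs]

/-- An element of `Φ(A)^pf` with `N`-th power in the image of `ι` is `ι_N` of that element:
`z^N = ι a ⟹ z = ι_N a`. [cite: MochizukiFrdI2008, §0 p.11] -/
theorem eq_toPerfectionRoot_of_pow_eq (N : ℕ+) (A : Dᵒᵖ) {z : (perfectionFunctor Φ).obj A} {a : Φ.obj A}
    (h : z ^ (N : ℕ) = ((toPerfectionFunctor Φ).app A).hom a) : z = ((toPerfectionRoot Φ N).app A).hom a := by
  exact Perfection.root_unique N h

end OnD

end Literature.AlgebraicGeometry.Frobenioids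

end
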